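import Mathlib
import Literature.AlgebraicGeometry.Resolution.MuPTorsorLocalUniformizationRelative
import Literature.AlgebraicGeometry.Resolution.RegularLocalRingsQuotient
import Summits.ResolutionOfSingularities.ResolutionOfSingularities.Theorems.SoloInformedTorsorExits
import Summits.ResolutionOfSingularities.ResolutionOfSingularities.Theorems.SoloInformedToroidalExit
import HarnessLib

/-!
# The summit with both elementary exits of the `μ_p`-torsor step removed (soloist, informed, s5)

Sorry-free. `SoloInformedTorsorExits` (Lemma U: residually inseparable presentations) and
`SoloInformedToroidalExit` (Lemma T₁: one-parameter toroidal presentations) each solve the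
model-form `μ_p`-torsor core step `RelMuPTorsorCoreStepsAt p k O` at the instances `A₀` admitting
the respective presentation of `a`. Here:

* `not_mem_sq_maximalIdeal_locAtCentre`: an element of a dominated local ring `T ⊆ O` whose value
  is MAXIMAL among the values `< 1` of `O` (a uniformizer of `O` lying in `T`, when `O` is
  discrete of rank one) is never in `𝔪_T²`; hence (`exists_model_of_uniformizerPresentation`)
  the hypothesis "`T/(x)` regular" of Lemma T₁ is automatic for such `x`: along a DVR every
  presentation `a^p = q^p + w·x^b`, `p ∤ b`, `w` a unit, `x ∈ A₀` a uniformizer of `O`,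
  solves the step — the defectless ramified layers are never the obstruction;
* `relMuPTorsorCoreStepsAt_iff_noExit`: the core step is equivalent to itself restricted to the
  instances with NEITHER a U- NOR a T₁-presentation over `A₀`;
* `resolutionOfSingularities_iff_twoModelPatching_and_rankOneNoExitCoreSteps`: granted Temkin's
  inseparable local uniformization in height one and Cossart–Piltant (`dim ≤ 3`), the summit is
  equivalent to two-model patching plus these doubly restricted core steps at rank-one `O`.

References: Matsumura, *Commutative Ring Theory*, Thms. 14.2, 23.7; Temkin (2013) Thm. 1.3.2;
Cossart–Piltant (2019) Thm. 1.1.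
-/

noncomputable section

namespace Summit.ResolutionOfSingularities.ResolutionOfSingularities.Theorems

open IsLocalRing Literature.AlgebraicGeometry.Resolution

variable {k K : Type} [Field k] [Field K] [Algebra k K]

/-- An element of maximal value `< 1` is not in `𝔪_T²` for any local ring `T ⊆ O` dominated by
`O` (here `T = B_{𝔪_O ∩ B}`): products of two non-units of `T` have value `≤ v(x)² < v(x)`.
[folklore] -/
theorem not_mem_sq_maximalIdeal_locAtCentre (O : ValuationSubring K) {B : Subring K}
    (hB : B ≤ O.toSubring) {x : K} (hxB : x ∈ locAtCentre B O) (hx0 : x ≠ 0)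
    (hvx : O.valuation x < 1)
    (hmax : ∀ y : K, O.valuation y < 1 → O.valuation y ≤ O.valuation x) :
    (haveI := isLocalRing_locAtCentre hB
    (⟨x, hxB⟩ : locAtCentre B O) ∉ (maximalIdeal (locAtCentre B O)) ^ 2) := by
  haveI := isLocalRing_locAtCentre hB
  intro hx2
  rw [pow_two] at hx2
  have key : ∀ z ∈ maximalIdeal (locAtCentre B O) * maximalIdeal (locAtCentre B O),
      O.valuation ((z : locAtCentre B O) : K) ≤ O.valuation x * O.valuation x := by
    intro z hz
    refine Submodule.mul_induction_on hz (fun m hm n hn => ?_) (fun y z hy hz => ?_)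
    · have hm' : O.valuation (m : K) < 1 :=
        (not_isUnit_locAtCentre_iff hB m).mp ((mem_maximalIdeal _).mp hm)
      have hn' : O.valuation (n : K) < 1 :=
        (not_isUnit_locAtCentre_iff hB n).mp ((mem_maximalIdeal _).mp hn)
      change O.valuation ((m : K) * n) ≤ _
      rw [map_mul]
      exact mul_le_mul' (hmax _ hm') (hmax _ hn')
    · change O.valuation ((y : K) + z) ≤ _
      exact (O.valuation.map_add _ _).trans (max_le hy hz)
  have h := key _ hx2
  have hvx0 : O.valuation x ≠ 0 := (Valuation.ne_zero_iff _).mpr hx0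
  have hlt : O.valuation x * O.valuation x < 1 * O.valuation x :=
    mul_lt_mul_of_pos_right hvx (zero_lt_iff.mpr hvx0)
  rw [one_mul] at hlt
  exact lt_irrefl _ (lt_of_le_of_lt h hlt)

/-- **Lemma T₁ along a uniformizer.** In the setting of `RelMuPTorsorCoreStepsAt p k O`, a
presentation `a ^ p = q ^ p + w · x ^ b` with `q, w, x ∈ A₀`, `p ∤ b`, `w` a unit of `O` and
`x ≠ 0` of MAXIMAL value `< 1` in `O` (a uniformizer of `O`, if `O` is a DVR) solves the instance
`A₀`: `T/(x)` is regular since `x ∉ 𝔪_T²`, and Lemma T₁ applies. [cite: Matsumura1987, Thm. 14.2] -/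
theorem exists_model_of_uniformizerPresentation {p : ℕ} [hp : Fact p.Prime] [CharP K p]
    (O : ValuationSubring K) (A₀ : Subalgebra k K) (h₀ : A₀.toSubring ≤ O.toSubring)
    (hA₀fg : A₀.FG) (hreg :
      IsRegularLocalRing (Localization.AtPrime ((maximalIdeal O).comap (Subring.inclusion h₀))))
    {a q w x : K} {b : ℕ} (hq : q ∈ A₀) (hw : w ∈ A₀) (hx : x ∈ A₀) (hpb : ¬ p ∣ b)
    (hvw : O.valuation w = 1) (hvx : O.valuation x < 1) (hx0 : x ≠ 0)
    (hmax : ∀ y : K, O.valuation y < 1 → O.valuation y ≤ O.valuation x)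
    (hf : a ^ p = q ^ p + w * x ^ b) :
    ∃ (A : Subalgebra k K) (h : A.toSubring ≤ O.toSubring), A₀ ≤ A ∧ a ∈ A ∧ A.FG ∧
      (A : Set K) ⊆ IntermediateField.adjoin k (insert a (A₀ : Set K)) ∧
      IsRegularLocalRing (Localization.AtPrime ((maximalIdeal O).comap (Subring.inclusion h))) := by
  haveI hT : IsRegularLocalRing (locAtCentre A₀.toSubring O) :=
    (isRegularLocalRing_locAtCentre_iff h₀).mpr hreg
  have hxT : x ∈ locAtCentre A₀.toSubring O := le_locAtCentre _ O hx
  have hxm : (⟨x, hxT⟩ : locAtCentre A₀.toSubring O) ∈ maximalIdeal _ :=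
    (mem_maximalIdeal _).mpr ((not_isUnit_locAtCentre_iff h₀ _).mpr hvx)
  have hx2 := not_mem_sq_maximalIdeal_locAtCentre O h₀ hxT hx0 hvx hmax
  exact exists_model_of_toroidalPresentation₁ O A₀ h₀ hA₀fg hreg hq hw hx hpb hvw hvx hx0 hf
    (IsRegularLocalRing.quotient_span_singleton hxm hx2).1

/-- **The core step minus both exits.** `RelMuPTorsorCoreStepsAt p k O` is equivalent to itself
restricted to the instances `A₀` with NEITHER a residually inseparable presentation
(`a^p = q^p + m^p u`, `ū ∉ κ(T)^p`; Lemma U) NOR a one-parameter toroidal presentation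
(`a^p = q^p + w x^b`, `p ∤ b`, `w` a unit, `T/(x)` regular; Lemma T₁) over `A₀`.
[cite: Matsumura1987, Thms. 14.2, 23.7 (ii)] -/
theorem relMuPTorsorCoreStepsAt_iff_noExit {p : ℕ} [Fact p.Prime] [CharP K p]
    (O : ValuationSubring K) :
    RelMuPTorsorCoreStepsAt p k O ↔
      (∀ (A₀ : Subalgebra k K) (h₀ : A₀.toSubring ≤ O.toSubring) (a : K), A₀.FG →
        IsRegularLocalRing
          (Localization.AtPrime ((maximalIdeal O).comap (Subring.inclusion h₀))) →
        a ∉ IntermediateField.adjoin k (A₀ : Set K) → a ^ p ∈ A₀ →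
        3 < Algebra.trdeg k ↥(IntermediateField.adjoin k (insert a (A₀ : Set K))) →
        ¬ IsAbhyankarPlace
            (O.comap (algebraMap ↥(IntermediateField.adjoin k (insert a (A₀ : Set K))) K))
            (algebraMap k ↥(IntermediateField.adjoin k (insert a (A₀ : Set K)))).fieldRange ⊤ →
        (¬ ∃ q m u : K, q ∈ A₀ ∧ m ∈ A₀ ∧ m ≠ 0 ∧ u ∈ A₀ ∧ a ^ p = q ^ p + m ^ p * u ∧
            ∀ b ∈ locAtCentre A₀.toSubring O, O.valuation (b ^ p - u) = 1) →
        (¬ ∃ (q w x : K) (b : ℕ) (hx : x ∈ A₀), q ∈ A₀ ∧ w ∈ A₀ ∧ ¬ p ∣ b ∧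
            O.valuation w = 1 ∧ O.valuation x < 1 ∧ x ≠ 0 ∧ a ^ p = q ^ p + w * x ^ b ∧
            IsRegularLocalRing (↥(locAtCentre A₀.toSubring O) ⧸ Ideal.span
              {(⟨x, le_locAtCentre A₀.toSubring O hx⟩ : locAtCentre A₀.toSubring O)})) →
        ∃ (A : Subalgebra k K) (h : A.toSubring ≤ O.toSubring), A₀ ≤ A ∧ a ∈ A ∧ A.FG ∧
          (A : Set K) ⊆ IntermediateField.adjoin k (insert a (A₀ : Set K)) ∧
          IsRegularLocalRing
            (Localization.AtPrime ((maximalIdeal O).comap (Subring.inclusion h)))) := by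
  rw [relMuPTorsorCoreStepsAt_iff_noUExit O]
  constructor
  · intro H A₀ h₀ a hfg hreg hna hap htr hnA hnU _
    exact H A₀ h₀ a hfg hreg hna hap htr hnA hnU
  · intro H A₀ h₀ a hfg hreg hna hap htr hnA hnU
    by_cases hex : ∃ (q w x : K) (b : ℕ) (hx : x ∈ A₀), q ∈ A₀ ∧ w ∈ A₀ ∧ ¬ p ∣ b ∧
        O.valuation w = 1 ∧ O.valuation x < 1 ∧ x ≠ 0 ∧ a ^ p = q ^ p + w * x ^ b ∧
        IsRegularLocalRing (↥(locAtCentre A₀.toSubring O) ⧸ Ideal.span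
          {(⟨x, le_locAtCentre A₀.toSubring O hx⟩ : locAtCentre A₀.toSubring O)})
    · obtain ⟨q, w, x, b, hx, hq, hw, hpb, hvw, hvx, hx0, hf, hxreg⟩ := hex
      exact exists_model_of_toroidalPresentation₁ O A₀ h₀ hfg hreg hq hw hx hpb hvw hvx hx0 hf
        hxreg
    · exact H A₀ h₀ a hfg hreg hna hap htr hnA hnU hex

/-- **The summit, with both elementary exits removed from its local core.** Granted Temkin's
inseparable local uniformization in height one and Cossart–Piltant in dimension `≤ 3` (as in
`SoloInformedRankOne`), resolution of singularities in positive characteristic is EQUIVALENT to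
two-model patching of proper models together with the model-form `μ_p`-torsor core steps at
rank-one valuation rings, at the instances admitting NEITHER a residually inseparable (Lemma U)
NOR a one-parameter toroidal (Lemma T₁) presentation.
[cite: Matsumura1987, Thms. 14.2, 23.7; Temkin2013, Thm. 1.3.2; CossartPiltant2019, Thm. 1.1] -/
theorem resolutionOfSingularities_iff_twoModelPatching_and_rankOneNoExitCoreSteps
    (hT₁ : Temkin2013HeightLeOne.{0}) (hCP : CossartPiltant2019LU3.{0}) :
    Literature.AlgebraicGeometry.Resolution.ResolutionOfSingularities ↔
      ∀ p : ℕ, p.Prime → ProperModel.TwoModelPatching.{0} p ∧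
      (∀ (k K : Type) [Field k] [CharP k p] [Field K] [Algebra k K],
        (⊤ : IntermediateField k K).FG → ∀ O : ValuationSubring K,
          Nonempty O.valuation.RankOne → (∀ c : k, algebraMap k K c ∈ O) →
            (∀ (A₀ : Subalgebra k K) (h₀ : A₀.toSubring ≤ O.toSubring) (a : K), A₀.FG →
            IsRegularLocalRing
              (Localization.AtPrime ((maximalIdeal O).comap (Subring.inclusion h₀))) →
            a ∉ IntermediateField.adjoin k (A₀ : Set K) → a ^ p ∈ A₀ →
            3 < Algebra.trdeg k ↥(IntermediateField.adjoin k (insert a (A₀ : Set K))) →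
            ¬ IsAbhyankarPlace
                (O.comap (algebraMap ↥(IntermediateField.adjoin k (insert a (A₀ : Set K))) K))
                (algebraMap k ↥(IntermediateField.adjoin k (insert a (A₀ : Set K)))).fieldRange ⊤ →
            (¬ ∃ q m u : K, q ∈ A₀ ∧ m ∈ A₀ ∧ m ≠ 0 ∧ u ∈ A₀ ∧ a ^ p = q ^ p + m ^ p * u ∧
                ∀ b ∈ locAtCentre A₀.toSubring O, O.valuation (b ^ p - u) = 1) →
            (¬ ∃ (q w x : K) (b : ℕ) (hx : x ∈ A₀), q ∈ A₀ ∧ w ∈ A₀ ∧ ¬ p ∣ b ∧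
                O.valuation w = 1 ∧ O.valuation x < 1 ∧ x ≠ 0 ∧ a ^ p = q ^ p + w * x ^ b ∧
                IsRegularLocalRing (↥(locAtCentre A₀.toSubring O) ⧸ Ideal.span
                  {(⟨x, le_locAtCentre A₀.toSubring O hx⟩ : locAtCentre A₀.toSubring O)})) →
            ∃ (A : Subalgebra k K) (h : A.toSubring ≤ O.toSubring), A₀ ≤ A ∧ a ∈ A ∧ A.FG ∧
              (A : Set K) ⊆ IntermediateField.adjoin k (insert a (A₀ : Set K)) ∧
              IsRegularLocalRing
                (Localization.AtPrime ((maximalIdeal O).comap (Subring.inclusion h))))) := by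
  rw [resolutionOfSingularities_iff_twoModelPatching_and_rankOneRelCoreSteps hT₁ hCP]
  refine forall₂_congr fun p hp => and_congr_right fun _ => forall₂_congr fun k K => ?_
  refine forall₄_congr fun _ _ _ _ => forall₃_congr fun _ O _ => forall_congr' fun _ => ?_
  haveI : Fact p.Prime := ⟨hp⟩
  haveI : CharP K p := charP_of_injective_algebraMap (algebraMap k K).injective p
  exact relMuPTorsorCoreStepsAt_iff_noExit O

end Summit.ResolutionOfSingularities.ResolutionOfSingularities.Theorems

end
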